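import Literature.Analysis.FluidPDE.KNSSTypeIRateLiouvilleDescent
import Literature.Analysis.FluidPDE.KNSSLiouvillePlanarHolds
import Literature.Analysis.FluidPDE.KNSSThm52Assembly
import Literature.Analysis.FluidPDE.AncientMildWeak
import Literature.Analysis.FluidPDE.RotatedDSSLimitStructure
import HarnessLib

/-!
# Bounded ancient solutions invariant along one direction, I: Lemma 2.1 on directional
# derivatives, and the planar components

Analysis/FluidPDE proofs file (theorems only; no definitions, no named facts), first of three
(`KNSSLineInvariantPlanar`, `KNSSLineInvariantVorticity`, `KNSSLineInvariantLiouville`) proving the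
folklore corollary of Koch–Nadirashvili–Seregin–Šverák, *Liouville theorems for the Navier–Stokes
equations and applications*, Acta Math. 203 (2009) 83–105 = arXiv:0709.3599, **Theorem 5.1**
(planar Liouville theorem) with **§4** (regularity of bounded weak solutions) and **Lemma 2.1**
(stability of the strong maximum principle) — used by KNSS themselves in the proof of Theorem 6.2
(arXiv p. 13: "`w` is independent of the `x₂`-variable. Applying Theorem 5.1 …") under a Type-I
rate, and classical for `2½`-dimensional flows (Majda–Bertozzi, *Vorticity and Incompressible
Flow*, CUP 2002, §2.3.1):

> a bounded ancient (mild / weak) solution of Navier–Stokes on `ℝ³ × (−∞, 0)` which is invariant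
> under the translations along one fixed direction is constant in space on every time slice,
> `u(t, x) = b(t)`.

This file (`ν = 1`; the invariant direction is the Lean coordinate `1`, KNSS's `x₂`):

* `directionalDeriv_nonpos_of_lemma21` — **a directional derivative of a bounded function that
  lies in the class of Lemma 2.1 is `≤ 0`** (any finite-dimensional `E`): if `f` solves
  `fₜ + a·∇f = Δf` in the elementary class of `KNSS2009_lemma21_halfball` with a bounded
  measurable drift and every slice is `f(t, ·) = ∂ₑ w` for some differentiable `|w| ≤ K`, then
  `sup f ≤ 0`: otherwise Lemma 2.1 (`KNSS2009_lemma21_halfball_holds`) gives balls of every radius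
  `R` on which `∂ₑ w ≥ sup f / 2`, and integrating along a diameter parallel to `e` gives
  `(sup f / 2) R ≤ 2K` — the one-dimensional substitute for the flux bound of the printed proof of
  Theorem 5.1 (p. 9).
* `planar_apply_eq_of_lineInvariant` — **the planar components are constant in space**: for a
  bounded ancient mild solution `u` (duality form, `IsBoundedAncientMildSolution 1 u`) jointly
  continuous on `(−∞, 0) × ℝ³` and invariant under `x ↦ x + δe₁`, the components `u₀, u₂` do not
  depend on `x`, for **every** `t < 0`: `u` is a bounded weak solution
  (`IsBoundedAncientMildSolution.isBoundedWeakNSSolutionOn`), its planar trace is a bounded weak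
  solution on `ℝ² × (−∞, 0)` (`IsBoundedWeakNSSolutionOn.planarTrace_of_lineInvariant`, the
  descent lemma), Theorem 5.1 (`KNSS2009_liouville_planar_holds`) makes the trace `β(t)` a.e., and
  continuity upgrades "a.e." to "everywhere" (slices by `continuous_slice_of_continuousOn_Iio`,
  time lines by
  `eq_of_ae_restrict_Iio_of_continuousOn`).

Everything rests on DISCHARGED tree theorems; the only hypotheses beyond the solution class are
joint continuity (needed to read the solution on the measure-zero plane `x₁ = 0`; it holds for the
blow-up limits of KNSS §6, which are smooth) and the pointwise invariance.

## References

* G. Koch, N. Nadirashvili, G. Seregin, V. Šverák, *Liouville theorems for the Navier–Stokes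
  equations and applications*, Acta Math. 203 (2009) 83–105 = arXiv:0709.3599: Theorem 5.1 and
  its proof (p. 9), Lemma 2.1 (p. 5), §4 (p. 8), proof of Theorem 6.2 (p. 13).
  [KochNadirashviliSereginSverak2009]
* A. J. Majda, A. L. Bertozzi, *Vorticity and Incompressible Flow*, CUP 2002, §2.3.1
  (`2½`-dimensional flows). [MajdaBertozziCUP2002]
-/

noncomputable section

open Set Function Filter MeasureTheory Topology InnerProductSpace WithLp intervalIntegral
open scoped RealInnerProductSpace Laplacian ContDiff

namespace Literature.Analysis.FluidPDE

/-! ### A directional derivative of a bounded function in the class of Lemma 2.1 is `≤ 0` -/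

section DirectionalDerivative

variable {E : Type*} [NormedAddCommGroup E] [InnerProductSpace ℝ E] [FiniteDimensional ℝ E]
  [MeasurableSpace E] [BorelSpace E]

/-- **A directional derivative of a bounded function in the class of Lemma 2.1 is `≤ 0`.** Let
`f : ℝ → E → ℝ` satisfy the hypotheses of `KNSS2009_lemma21_halfball` on `E × (−∞, 0)` (bounded,
`C²` slices, bounded and jointly continuous `Df`, `Δf`, the integrated drift–diffusion equation
`fₜ + a·∇f = Δf` with a bounded measurable drift `a`), and suppose every slice `f(t, ·)`, `t < 0`,
is the derivative `∂ₑ w` along a fixed unit vector `e` of some differentiable `w` with `|w| ≤ K`.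
Then `f ≤ 0`. (KNSS 2009, proof of Theorem 5.1, p. 9, with the flux bound replaced by its
one-dimensional form: if `M₁ = sup f > 0`, Lemma 2.1 gives balls `B(ȳ, R) × (t̄ − R², t̄)` of
every radius on which `∂ₑ w ≥ M₁/2`, and then
`M₁ R / 2 ≤ w(ȳ + (R/2)e) − w(ȳ − (R/2)e) ≤ 2K` at the time `t̄ − R²/2`.) [cite: KochNadirashviliSereginSverak2009, Lemma 2.1 (arXiv p. 5) and proof of Thm 5.1 (p. 9)] -/
theorem directionalDeriv_nonpos_of_lemma21 {f : ℝ → E → ℝ} {a : ℝ → E → E} {A K : ℝ} {e : E}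
    (he : ‖e‖ = 1) (ha : Measurable (uncurry a)) (haA : ∀ t < 0, ∀ y, ‖a t y‖ ≤ A)
    (hfb : ∃ C : ℝ, ∀ t < 0, ∀ y, |f t y| ≤ C) (hf2 : ∀ t < 0, ContDiff ℝ 2 (f t))
    (hfD : ∃ C : ℝ, ∀ t < 0, ∀ y, ‖fderiv ℝ (f t) y‖ ≤ C ∧ |(Δ (f t)) y| ≤ C)
    (hcD : ContinuousOn (fun p : ℝ × E => fderiv ℝ (f p.1) p.2) (Iio 0 ×ˢ univ))
    (hcΔ : ContinuousOn (fun p : ℝ × E => (Δ (f p.1)) p.2) (Iio 0 ×ˢ univ))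
    (heq : ∀ y, ∀ s t : ℝ, s ≤ t → t < 0 →
      f t y - f s y = ∫ τ in s..t, ((Δ (f τ)) y - fderiv ℝ (f τ) y (a τ y)))
    (hrep : ∀ t < 0, ∃ w : E → ℝ, Differentiable ℝ w ∧ (∀ x, |w x| ≤ K) ∧
      ∀ x, f t x = fderiv ℝ w x e) :
    ∀ t < 0, ∀ y, f t y ≤ 0 := by
  by_contra hcon
  push Not at hcon
  obtain ⟨t₀, ht₀, y₀, hy₀⟩ := hcon
  obtain ⟨C, hC⟩ := hfb
  -- the set of values of `f` on the slab and its supremum `M₁ > 0`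
  set S : Set ℝ := (fun p : ℝ × E => f p.1 p.2) '' (Iio (0 : ℝ) ×ˢ (univ : Set E)) with hS
  have hbdd : BddAbove S := by
    refine ⟨C, ?_⟩
    rintro r ⟨⟨t, y⟩, ⟨ht, -⟩, rfl⟩
    exact (le_abs_self _).trans (hC t ht y)
  have hmem : ∀ t < 0, ∀ y, f t y ∈ S := fun t ht y => ⟨(t, y), ⟨ht, mem_univ _⟩, rfl⟩
  have hne : S.Nonempty := ⟨_, hmem t₀ ht₀ y₀⟩
  set M₁ : ℝ := sSup S with hM₁
  have hle : ∀ t < 0, ∀ y, f t y ≤ M₁ := fun t ht y => le_csSup hbdd (hmem t ht y)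
  have hpos : 0 < M₁ := hy₀.trans_le (hle t₀ ht₀ y₀)
  have happ : ∀ ε > 0, ∃ t < 0, ∃ y, M₁ - ε < f t y := by
    intro ε hε
    obtain ⟨r, ⟨⟨t, y⟩, ⟨ht, -⟩, rfl⟩, hr⟩ :=
      exists_lt_of_lt_csSup hne (by linarith : M₁ - ε < sSup S)
    exact ⟨t, ht, y, hr⟩
  -- Lemma 2.1: balls of every radius on which `f ≥ M₁ / 2`
  have H := KNSS2009_lemma21_halfball_holds (E := E) ha haA ⟨C, hC⟩ hf2 hfD hcD hcΔ heq hle happ hpos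
  -- the radius for which the one-dimensional flux bound fails
  set R : ℝ := (4 * |K| + 4) / M₁ with hR
  have hRpos : 0 < R := by positivity
  obtain ⟨y₁, t₁, ht₁, hball⟩ := H R hRpos
  have ht₂ : t₁ - R ^ 2 / 2 ∈ Ioo (t₁ - R ^ 2) t₁ := by
    constructor <;> nlinarith [sq_nonneg R, hRpos]
  have ht₂' : t₁ - R ^ 2 / 2 < 0 := by nlinarith [sq_nonneg R]
  obtain ⟨w, hw, hwK, hfw⟩ := hrep _ ht₂'
  -- the function `w` along the diameter of the ball parallel to `e`
  set φ : ℝ → ℝ := fun r => w (y₁ + r • e) with hφ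
  have hφd : ∀ r, HasDerivAt φ (f (t₁ - R ^ 2 / 2) (y₁ + r • e)) r := by
    intro r
    have h1 : HasDerivAt (fun r : ℝ => y₁ + r • e) e r := by
      simpa using ((hasDerivAt_id r).smul_const e).const_add y₁
    have h2 := (hw (y₁ + r • e)).hasFDerivAt.comp_hasDerivAt r h1
    rw [hfw]
    exact h2
  have hφc : Continuous φ := continuous_iff_continuousAt.2 fun r => (hφd r).continuousAt
  have hmem_ball : ∀ r ∈ Ioo (-(R / 2)) (R / 2), y₁ + r • e ∈ Metric.ball y₁ R := by
    intro r hr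
    rw [Metric.mem_ball, dist_eq_norm, add_sub_cancel_left, norm_smul, he, mul_one, Real.norm_eq_abs,
      abs_lt]
    constructor <;> linarith [hr.1, hr.2]
  have hderiv : ∀ r ∈ interior (Icc (-(R / 2)) (R / 2)), M₁ / 2 ≤ deriv φ r := by
    intro r hr
    rw [interior_Icc] at hr
    rw [(hφd r).deriv]
    exact hball _ ht₂ _ (hmem_ball r hr)
  have hmvt := (convex_Icc (-(R / 2)) (R / 2)).mul_sub_le_image_sub_of_le_deriv hφc.continuousOn
    (fun r _ => (hφd r).differentiableAt.differentiableWithinAt) hderiv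
    (-(R / 2)) (left_mem_Icc.2 (by linarith)) (R / 2) (right_mem_Icc.2 (by linarith)) (by linarith)
  -- `M₁ R / 2 ≤ φ(R/2) − φ(−R/2) ≤ 2 |K|`, while `M₁ R / 2 = 2 |K| + 2`
  have hup : φ (R / 2) - φ (-(R / 2)) ≤ 2 * |K| := by
    have h1 := (abs_le.1 ((hwK (y₁ + (R / 2) • e)).trans (le_abs_self K))).2
    have h2 := (abs_le.1 ((hwK (y₁ + (-(R / 2)) • e)).trans (le_abs_self K))).1
    simp only [hφ] at *
    linarith
  have hval : M₁ / 2 * (R / 2 - -(R / 2)) = 2 * |K| + 2 := by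
    rw [hR]
    field_simp
    ring
  linarith [abs_nonneg K]

end DirectionalDerivative

/-! ### The planar components of a line-invariant bounded ancient solution are constant in space -/

section Planar

/-- A point of `ℝ³` is its trace on the plane `x₁ = 0` plus its `e₁`-component. [folklore] -/
private theorem eq_planarPoint_add_single (x : (EuclideanSpace ℝ (Fin 3))) :
    x = (toLp 2 ![x 0, 0, x 2] : (EuclideanSpace ℝ (Fin 3))) + EuclideanSpace.single 1 (x 1) := by
  ext j
  fin_cases j <;> simp

/-- The time lines of a jointly continuous family are continuous on `(−∞, 0)`. [folklore] -/
private theorem continuousOn_timeLine_of_continuousOn {X Y : Type*} [TopologicalSpace X] [TopologicalSpace Y]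
    {u : ℝ → X → Y} (hcont : ContinuousOn (uncurry u) (Iio 0 ×ˢ univ)) (x : X) :
    ContinuousOn (fun t => u t x) (Iio 0) :=
  hcont.comp (f := fun t : ℝ => (t, x)) (continuous_id.prodMk continuous_const).continuousOn
    fun _ ht => ⟨ht, mem_univ _⟩

/-- **The planar components of a line-invariant bounded ancient mild solution are constant in
space** (KNSS 2009, Theorem 5.1 through the descent lemma). Let `u` be a bounded ancient mild
solution of Navier–Stokes (`ν = 1`, duality form), jointly continuous on `(−∞, 0) × ℝ³` and
invariant under the translations `x ↦ x + δe₁`. Then for **every** `t < 0` and every `x`,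
`u₀(t, x) = u₀(t, 0)` and `u₂(t, x) = u₂(t, 0)`: the planar trace
`V(t, y) = (u₀, u₂)(t, (y₀, 0, y₁))` is a bounded weak solution on `ℝ² × (−∞, 0)`
(`IsBoundedAncientMildSolution.isBoundedWeakNSSolutionOn`,
`IsBoundedWeakNSSolutionOn.planarTrace_of_lineInvariant`), hence `V(t, ·) = β(t)` a.e. for a.e.
`t` by Theorem 5.1 (`KNSS2009_liouville_planar_holds`); continuity in `y`, the invariance and
continuity in `t` upgrade this to every `(t, x)`. [cite: KochNadirashviliSereginSverak2009, Thm 5.1 (arXiv p. 9) and proof of Thm 6.2 (p. 13)] -/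
theorem planar_apply_eq_of_lineInvariant {u : ℝ → (EuclideanSpace ℝ (Fin 3)) → (EuclideanSpace ℝ (Fin 3))}
    (hu : IsBoundedAncientMildSolution 1 u) (hcont : ContinuousOn (uncurry u) (Iio 0 ×ˢ univ))
    (hinv : ∀ t < 0, ∀ (x : (EuclideanSpace ℝ (Fin 3))) (δ : ℝ), u t (x + EuclideanSpace.single 1 δ) = u t x) :
    ∀ t < 0, ∀ x : (EuclideanSpace ℝ (Fin 3)), u t x 0 = u t 0 0 ∧ u t x 2 = u t 0 2 := by
  -- `u` is a bounded weak solution in the class of KNSS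
  have hmeas : AEStronglyMeasurable (uncurry u)
      ((volume : Measure (ℝ × (EuclideanSpace ℝ (Fin 3)))).restrict (Iio 0 ×ˢ univ)) :=
    hcont.aestronglyMeasurable (measurableSet_Iio.prod MeasurableSet.univ)
  have hslc : ∀ t < 0, Continuous (u t) := fun t ht => continuous_slice_of_continuousOn_Iio hcont ht
  have hsl : ∀ t < 0, AEStronglyMeasurable (u t) volume := fun t ht =>
    (hslc t ht).aestronglyMeasurable
  have hw : IsBoundedWeakNSSolutionOn (Iio 0) isOpen_Iio 1 u :=
    hu.isBoundedWeakNSSolutionOn one_pos hmeas hsl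
  have hdiv : ∀ t ∈ Iio (0 : ℝ), IsWeaklyDivFree (u t) := fun t ht => hu.1.1 t ht
  -- descent to the plane and Theorem 5.1
  have hV := hw.planarTrace_of_lineInvariant hcont (fun t ht x δ => hinv t ht x δ) hdiv
  obtain ⟨β, -, -, hβ⟩ := KNSS2009_liouville_planar_holds hV
  -- the embedding of the plane as a continuous linear map
  set L : (EuclideanSpace ℝ (Fin 2)) →L[ℝ] (EuclideanSpace ℝ (Fin 3)) :=
    (EuclideanSpace.proj (0 : Fin 2)).smulRight (EuclideanSpace.single (0 : Fin 3) (1 : ℝ)) +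
      (EuclideanSpace.proj (1 : Fin 2)).smulRight (EuclideanSpace.single (2 : Fin 3) (1 : ℝ))
    with hLdef
  have hL : ∀ y : (EuclideanSpace ℝ (Fin 2)), L y = toLp 2 ![y 0, 0, y 1] := by
    intro y; rw [hLdef]; ext j; fin_cases j <;> simp
  -- for a.e. `t`: the planar components are constant on the plane `x₁ = 0`, hence everywhere
  have hae : ∀ᵐ t ∂((volume : Measure ℝ).restrict (Iio 0)),
      ∀ x : (EuclideanSpace ℝ (Fin 3)), u t x 0 - u t 0 0 = 0 ∧ u t x 2 - u t 0 2 = 0 := by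
    filter_upwards [hβ, ae_restrict_mem measurableSet_Iio] with t ht htneg
    have htneg : t < 0 := htneg
    -- componentwise a.e. identities on the plane
    have h0 : (fun y : (EuclideanSpace ℝ (Fin 2)) => u t (L y) 0) =ᵐ[volume] fun _ => β t 0 := by
      filter_upwards [ht] with y hy
      have := congr_arg (fun v : (EuclideanSpace ℝ (Fin 2)) => v 0) hy
      simpa [hL] using this
    have h2 : (fun y : (EuclideanSpace ℝ (Fin 2)) => u t (L y) 2) =ᵐ[volume] fun _ => β t 1 := by
      filter_upwards [ht] with y hy
      have := congr_arg (fun v : (EuclideanSpace ℝ (Fin 2)) => v 1) hy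
      simpa [hL] using this
    -- continuity upgrades them to every `y`
    have hc0 : Continuous fun y : (EuclideanSpace ℝ (Fin 2)) => u t (L y) 0 :=
      (EuclideanSpace.proj (0 : Fin 3)).continuous.comp ((hslc t htneg).comp L.continuous)
    have hc2 : Continuous fun y : (EuclideanSpace ℝ (Fin 2)) => u t (L y) 2 :=
      (EuclideanSpace.proj (2 : Fin 3)).continuous.comp ((hslc t htneg).comp L.continuous)
    have e0 := Measure.eq_of_ae_eq h0 hc0 continuous_const
    have e2 := Measure.eq_of_ae_eq h2 hc2 continuous_const
    -- every `x` is a translate along `e₁` of a point of the plane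
    have key : ∀ x : (EuclideanSpace ℝ (Fin 3)), u t x = u t (L (toLp 2 ![x 0, x 2])) := by
      intro x
      have hx : L (toLp 2 ![x 0, x 2]) = toLp 2 ![x 0, 0, x 2] := by
        rw [hL]; ext j; fin_cases j <;> simp
      rw [hx]
      conv_lhs => rw [eq_planarPoint_add_single x]
      exact hinv t htneg _ _
    have key0 : L (toLp 2 ![(0 : (EuclideanSpace ℝ (Fin 3))) 0, (0 : (EuclideanSpace ℝ (Fin 3))) 2]) = 0 := by
      rw [hL]; ext j; fin_cases j <;> simp
    intro x
    refine ⟨?_, ?_⟩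
    · rw [key x, key 0]
      have a := congr_fun e0 (toLp 2 ![x 0, x 2])
      have b := congr_fun e0 (toLp 2 ![(0 : (EuclideanSpace ℝ (Fin 3))) 0, (0 : (EuclideanSpace ℝ (Fin 3))) 2])
      simp only at a b
      rw [a, b, sub_self]
    · rw [key x, key 0]
      have a := congr_fun e2 (toLp 2 ![x 0, x 2])
      have b := congr_fun e2 (toLp 2 ![(0 : (EuclideanSpace ℝ (Fin 3))) 0, (0 : (EuclideanSpace ℝ (Fin 3))) 2])
      simp only at a b
      rw [a, b, sub_self]
  -- continuity in `t` upgrades "a.e. `t`" to every `t < 0`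
  intro t ht x
  have hc : ∀ i : Fin 3, ContinuousOn (fun s => u s x i - u s 0 i) (Iio 0) := fun i =>
    ((EuclideanSpace.proj i).continuous.comp_continuousOn (continuousOn_timeLine_of_continuousOn hcont x)).sub
      ((EuclideanSpace.proj i).continuous.comp_continuousOn (continuousOn_timeLine_of_continuousOn hcont 0))
  refine ⟨sub_eq_zero.1 (eq_of_ae_restrict_Iio_of_continuousOn (hc 0) (hae.mono fun s hs => (hs x).1) ht),
    sub_eq_zero.1 (eq_of_ae_restrict_Iio_of_continuousOn (hc 2) (hae.mono fun s hs => (hs x).2) ht)⟩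

end Planar

end Literature.Analysis.FluidPDE

end
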